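import Literature.AlgebraicGeometry.Surfaces.K3SurfaceProofs
import Summits.HodgeConjecture.HodgeConjecture.Theorems.NikulinTwinTransportRealMultiplicationCore
import HarnessLib

/-!
# Route NikulinTwinTransport · crux X = `TwinSimilitudeAlgebraic` (stmt-HodgeConjecture-13674) —
# stub `stub_cmPolyComplexify` of line `hyperkaehler-nikulin-anchors` (reshape r11): polynomials in a
# `ℚ`-rational endomorphism of `Λ_ℂ`

Let `Λ_ℂ = (K3Index → ℂ)` and `Λ_ℚ = (K3Index → ℚ) ⊂ Λ_ℂ` (coordinatewise cast). If a
`ℂ`-linear `J` restricts on `Λ_ℚ` to a `ℚ`-linear `Jq` (i.e. `J` is the complexification of `Jq`),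
then for every `q ∈ ℚ[X]` the endomorphism `q(J) := aeval J (q.map (algebraMap ℚ ℂ))` restricts on
`Λ_ℚ` to `q(Jq)` (`aeval_map_ratCastΛ`, by `Polynomial.induction_on`: constants act by the same
rational scalar, sums add, and `(p · X)(J) = p(J) ∘ J`), and consequently, if `q(Jq)` is an isometry
of the rational K3 form `k3FormRat`, then `q(J)` is an isometry of the complex K3 form `k3Form` on
all of `Λ_ℂ` (both sides are `ℂ`-bilinear and agree on the rational standard basis — the tree's
`k3Form_of_ratRestriction` with multiplier `1`). This is `stub_cmPolyComplexify`, the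
complexification step feeding the Cayley-transform decomposition of a CM `2`-similitude into
polynomial isometries. Stub worker of prover seat c6, line lead's skeleton r11.
-/

noncomputable section

set_option linter.dupNamespace false

open Polynomial
open Literature.AlgebraicGeometry.Surfaces

namespace Summit.HodgeConjecture.HodgeConjecture.Theorems.NikulinTwinTransport

/-- **Polynomials in a complexified endomorphism are complexified polynomials**: if the `ℂ`-linear
`J` of `Λ_ℂ` restricts on `Λ_ℚ` to the `ℚ`-linear `Jq`, then `q(J)` (with `q ∈ ℚ[X]` read in
`ℂ[X]`) restricts on `Λ_ℚ` to `q(Jq)`. [folklore] -/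
theorem aeval_map_ratCastΛ (J : Module.End ℂ (K3Index → ℂ)) (Jq : Module.End ℚ (K3Index → ℚ))
    (hJ : ∀ u : K3Index → ℚ, J (fun i => (u i : ℂ)) = fun i => (Jq u i : ℂ)) (q : ℚ[X])
    (u : K3Index → ℚ) :
    aeval J (q.map (algebraMap ℚ ℂ)) (fun i => (u i : ℂ)) = fun i => (aeval Jq q u i : ℂ) := by
  induction q using Polynomial.induction_on generalizing u with
  | C c =>
    rw [Polynomial.map_C, aeval_C, aeval_C, Module.algebraMap_end_apply,
      Module.algebraMap_end_apply, eq_ratCast, ratCastΛ_smul]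
  | add p q hp hq =>
    rw [Polynomial.map_add, map_add, map_add, LinearMap.add_apply, LinearMap.add_apply, hp, hq,
      ratCastΛ_add]
  | monomial n c h =>
    rw [pow_succ, ← mul_assoc, Polynomial.map_mul, map_mul, map_mul, Polynomial.map_X, aeval_X,
      aeval_X, Module.End.mul_apply, Module.End.mul_apply, hJ, h]

/-- **Complexification of polynomials in a `ℚ`-rational endomorphism of `Λ_ℂ`, and isometry
transfer.** If `J` restricts on `Λ_ℚ` to `Jq`, then for every `q ∈ ℚ[X]`: (i) `q(J)` restricts on
`Λ_ℚ` to `q(Jq)`; (ii) if `q(Jq)` is a `k3FormRat`-isometry then `q(J)` is a `k3Form`-isometry of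
`Λ_ℂ` (both sides `ℂ`-bilinear, equal on the rational standard basis). [folklore] -/
theorem stub_cmPolyComplexify :
    ∀ (J : Module.End ℂ (K3Index → ℂ)) (Jq : Module.End ℚ (K3Index → ℚ)),
      (∀ u : K3Index → ℚ, J (fun i => (u i : ℂ)) = fun i => (Jq u i : ℂ)) →
      ∀ q : Polynomial ℚ,
        (∀ u : K3Index → ℚ,
          Polynomial.aeval J (q.map (algebraMap ℚ ℂ)) (fun i => (u i : ℂ)) =
            fun i => (Polynomial.aeval Jq q u i : ℂ)) ∧
        ((∀ v w, k3FormRat (Polynomial.aeval Jq q v) (Polynomial.aeval Jq q w) = k3FormRat v w) →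
          ∀ a b, k3Form (Polynomial.aeval J (q.map (algebraMap ℚ ℂ)) a)
            (Polynomial.aeval J (q.map (algebraMap ℚ ℂ)) b) = k3Form a b) := by
  intro J Jq hJ q
  refine ⟨aeval_map_ratCastΛ J Jq hJ q, fun hq a b => ?_⟩
  have h := k3Form_of_ratRestriction (aeval J (q.map (algebraMap ℚ ℂ))) (aeval Jq q)
    (aeval_map_ratCastΛ J Jq hJ q) 1 (fun v w => by rw [hq, one_mul]) a b
  rwa [Rat.cast_one, one_mul] at h

end Summit.HodgeConjecture.HodgeConjecture.Theorems.NikulinTwinTransport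

end
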